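import Mathlib
import HarnessLib
import Summits.HubbardSuperconductivity.HubbardSuperconductivity.Theorems.KLProgrammeKLRegimeTwoVolumeTowerSrcScaledDefs

/-!
# Route `KLProgramme` — crux K3, VL child `KLRegimeVolumeLimitV17F2` (stmt-HubbardSuperconductivity-20440), blueprint v5 M5: THE SOURCE-RESCALED TOWER, KIT
# (located «SRC-DEG2», cure (β) of plan g22 (R171); seat hubbard-kl-k3c4-p1 g15; `--supports` 20440)

The nested two-volume induction of the VL child is re-threaded on the SOURCE-RESCALED states `klTowerStateS … t j = S_t (klTowerState … j)`
(`…TowerSrcScaledDefs`; [BGM06] §2.9 (4.6)–(4.8): the source legs are dead variables).  This file is the kit of that re-threading — the twin of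
`…TowerTruncKit` one level up:

* §1 (generic, `TwoVolumeDefect`, labels `Γ × Fin 2`): `srcScale` commutes with source truncation (`srcScale_srcTrunc_comm`), with the step of a covariance
  vanishing on the sources (`effAction_srcScale_comm`), with copy-diagonal substitutions (`map_toLin'_srcScale_comm`); parity (`srcScale_mem_evenOdd_zero`,
  `constPart_srcScale`); the keyed two-volume defect scales termwise by `t^{#source legs}` (`norm_keyed_kernel_srcScale_eq`), hence DECREASES under `S_t`,
  `0 ≤ t ≤ 1` (`sum_filter_norm_keyed_kernel_srcScale_le`) and, on the truncations to source degree `< kk`, is READ BACK with the factor `t⁻¹^(kk-1)`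
  (`sum_filter_norm_keyed_kernel_srcTrunc_le_inv_pow_mul`); weighted profiles decrease (`WtProfileEven.srcScale`, `WtProfileRaw.srcScale`);
* §2 (model, `TwoVolumeSource`): **`klTowerStateS_eq_srcScale`** (`klTowerStateS … t j = S_t (klTowerState … j)`), `klTowerDS_parity`, `srcTrunc_klTowerDS_parity`,
  **`map_klTowerTransfer_klTowerStateS`** (`map T_j (S_t state j) = S_t D_j`), `klTowerStateS_succ_eq_effAction_map`, **`srcTrunc_klTowerDS_eq_map`**,
  **`srcTrunc_klTowerStateS_succ`** (the rescaled truncated states obey the tower's recursion), `klKeyedDefectTS_le_klKeyedDefectT` (`0 ≤ t ≤ 1`),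
  `TowerVolumeDataT.scale` / `TowerDataT.scale` (the unscaled package yields the rescaled one at every `t ∈ [0,1]`).

Proofs only; no definition; nothing about the model is asserted. [cite: BenfattoGiulianiMastropietro2006, §2.9 (4.3)–(4.8); Salmhofer1999, App. B.2 (B.23)–(B.25)]
-/

noncomputable section

namespace Summit.HubbardSuperconductivity.HubbardSuperconductivity.Theorems.TwoVolumeDefect

set_option linter.dupNamespace false -- summit = problem name (single-conjunct summit), D-0017

open Finset Literature.MathematicalPhysics.QuantumLattice GrassmannAlgebra Literature.Probability.LatticeModels
  Literature.Probability.LatticeModels.BattleFederbush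

/-! ## §1 Generic: the source rescaling versus truncation, spectator steps, copy-diagonal substitutions, keyed defects and profiles -/

section Generic

variable {𝕜 : Type*} [RCLike 𝕜] {Γ₁ Γ₂ : Type*} [Fintype Γ₁] [DecidableEq Γ₁] [Fintype Γ₂] [DecidableEq Γ₂]

/-- **Source rescaling commutes with source truncation** (both are diagonal on the kernels). [cite: BenfattoGiulianiMastropietro2006, §2.9 (4.3)-(4.8)] -/
theorem srcScale_srcTrunc_comm (t : ℝ) (kk : ℕ) (X : GrassmannAlgebra 𝕜 (Γ₁ × Fin 2)) :
    srcScale 𝕜 t (srcTrunc 𝕜 (fun p : Γ₁ × Fin 2 => p.2 = 1) kk X) = srcTrunc 𝕜 (fun p : Γ₁ × Fin 2 => p.2 = 1) kk (srcScale 𝕜 t X) :=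
  grassmann_eq_of_kernel_eq fun m W => by
    rw [kernel_srcScale, kernel_srcTrunc, kernel_srcTrunc, kernel_srcScale]
    split_ifs
    · rfl
    · rw [mul_zero]

omit [Fintype Γ₁] [DecidableEq Γ₁] in
/-- **Source rescaling preserves evenness.** [folklore] -/
theorem srcScale_mem_evenOdd_zero (t : ℝ) {X : GrassmannAlgebra 𝕜 (Γ₁ × Fin 2)} (hX : X ∈ evenOdd 𝕜 0) : srcScale 𝕜 t X ∈ evenOdd 𝕜 0 :=
  map_mem_evenOdd_zero 𝕜 _ hX

omit [Fintype Γ₁] [DecidableEq Γ₁] in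
/-- **Source rescaling fixes the constant part.** [folklore] -/
theorem constPart_srcScale (t : ℝ) (X : GrassmannAlgebra 𝕜 (Γ₁ × Fin 2)) : constPart 𝕜 (srcScale 𝕜 t X) = constPart 𝕜 X := by
  rw [srcScale_apply]
  exact constPart_map 𝕜 _ X

/-- **The step of a covariance vanishing on the sources commutes with the source rescaling** (dead variables).
[cite: BenfattoGiulianiMastropietro2006, §2.9 (4.6)-(4.8)] -/
theorem effAction_srcScale_comm (t : ℝ) (C : Matrix (Γ₁ × Fin 2) (Γ₁ × Fin 2) 𝕜) (hC : ∀ X Y : Γ₁ × Fin 2, X.2 = 1 ∨ Y.2 = 1 → C X Y = 0)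
    (V : GrassmannAlgebra 𝕜 (Γ₁ × Fin 2)) :
    effAction 𝕜 C (srcScale 𝕜 t V) = srcScale 𝕜 t (effAction 𝕜 C V) := by
  rw [srcScale_apply, srcScale_apply]
  exact effAction_map_mulLeft_srcWeight 𝕜 (fun p : Γ₁ × Fin 2 => p.2 = 1) ((t : ℝ) : 𝕜) C hC V

/-- **A copy-diagonal substitution commutes with the source rescaling**: `map T′ (S_t X) = S_t (map T′ X)` when `T′ (x,s) (y,t) = 0` for `s ≠ t`.
[cite: Salmhofer1999, App. B.2 (B.23)-(B.25)] -/
theorem map_toLin'_srcScale_comm (T' : Matrix (Γ₂ × Fin 2) (Γ₁ × Fin 2) 𝕜) (hT : ∀ x s y t, s ≠ t → T' (x, s) (y, t) = 0) (t : ℝ)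
    (X : GrassmannAlgebra 𝕜 (Γ₁ × Fin 2)) :
    ExteriorAlgebra.map (Matrix.toLin' T') (srcScale 𝕜 t X) = srcScale 𝕜 t (ExteriorAlgebra.map (Matrix.toLin' T') X) := by
  rw [srcScale_apply, srcScale_apply]
  refine map_map_mulLeft_srcWeight_comm 𝕜 (fun p : Γ₁ × Fin 2 => p.2 = 1) (fun p : Γ₂ × Fin 2 => p.2 = 1) (Matrix.toLin' T') (fun Y Y' hM => ?_)
    ((t : ℝ) : 𝕜) X
  rw [LinearMap.toMatrix'_toLin'] at hM
  obtain ⟨y, u⟩ := Y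
  obtain ⟨x, s⟩ := Y'
  have hsu : s = u := by
    by_contra h
    exact hM (hT x s y u h)
  subst hsu
  exact Iff.rfl

omit [Fintype Γ₁] [DecidableEq Γ₁] [Fintype Γ₂] [DecidableEq Γ₂] in
/-- **The keyed two-volume defect scales termwise by `t^{#source legs}`** (the residue string of a doubled block structure keeping the copy has the same
source count). [cite: BenfattoGiulianiMastropietro2006, §2.9 (4.6)-(4.8)] -/
theorem norm_keyed_kernel_srcScale_eq [Fintype Γ₁] [DecidableEq Γ₁] [Fintype Γ₂] [DecidableEq Γ₂] {Bk : Type*} [DecidableEq Bk]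
    (ed₁ : (Γ₂ × Fin 2) ≃ Bk × (Γ₁ × Fin 2)) (hcopy : ∀ y : Γ₂ × Fin 2, ((ed₁ y).2).2 = y.2) {t : ℝ} (ht : 0 ≤ t)
    (A' : GrassmannAlgebra 𝕜 (Γ₂ × Fin 2)) (A : GrassmannAlgebra 𝕜 (Γ₁ × Fin 2)) {k : ℕ} (Y' : Fin k → Γ₂ × Fin 2) (p : Fin k) :
    ‖kernel 𝕜 (srcScale 𝕜 t A') k Y' - (if ∀ i, (ed₁ (Y' i)).1 = (ed₁ (Y' p)).1 then kernel 𝕜 (srcScale 𝕜 t A) k (fun i => (ed₁ (Y' i)).2) else 0)‖ =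
      t ^ srcCount (fun q : Γ₂ × Fin 2 => q.2 = 1) Y' *
        ‖kernel 𝕜 A' k Y' - (if ∀ i, (ed₁ (Y' i)).1 = (ed₁ (Y' p)).1 then kernel 𝕜 A k (fun i => (ed₁ (Y' i)).2) else 0)‖ := by
  rw [kernel_srcScale, kernel_srcScale, srcCount_residue_eq ed₁ hcopy]
  split_ifs
  · rw [← mul_sub, norm_mul, norm_pow, RCLike.norm_ofReal, abs_of_nonneg ht]
  · rw [sub_zero, sub_zero, norm_mul, norm_pow, RCLike.norm_ofReal, abs_of_nonneg ht]

omit [Fintype Γ₁] [DecidableEq Γ₁] [Fintype Γ₂] [DecidableEq Γ₂] in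
/-- **Keyed two-volume defects only decrease under the source rescaling**, `0 ≤ t ≤ 1` (summed, pinned form).
[cite: BenfattoGiulianiMastropietro2006, §2.9 (4.6)-(4.8)] -/
theorem sum_filter_norm_keyed_kernel_srcScale_le [Fintype Γ₁] [DecidableEq Γ₁] [Fintype Γ₂] [DecidableEq Γ₂] {Bk : Type*} [DecidableEq Bk]
    (ed₁ : (Γ₂ × Fin 2) ≃ Bk × (Γ₁ × Fin 2)) (hcopy : ∀ y : Γ₂ × Fin 2, ((ed₁ y).2).2 = y.2) {t : ℝ} (ht0 : 0 ≤ t) (ht1 : t ≤ 1)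
    (A' : GrassmannAlgebra 𝕜 (Γ₂ × Fin 2)) (A : GrassmannAlgebra 𝕜 (Γ₁ × Fin 2)) (k : ℕ) (p : Fin k) (y' : Γ₂ × Fin 2) :
    ∑ Y' ∈ univ.filter (fun Y' : Fin k → Γ₂ × Fin 2 => Y' p = y'),
        ‖kernel 𝕜 (srcScale 𝕜 t A') k Y' - (if ∀ i, (ed₁ (Y' i)).1 = (ed₁ (Y' p)).1 then kernel 𝕜 (srcScale 𝕜 t A) k (fun i => (ed₁ (Y' i)).2) else 0)‖ ≤
      ∑ Y' ∈ univ.filter (fun Y' : Fin k → Γ₂ × Fin 2 => Y' p = y'),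
        ‖kernel 𝕜 A' k Y' - (if ∀ i, (ed₁ (Y' i)).1 = (ed₁ (Y' p)).1 then kernel 𝕜 A k (fun i => (ed₁ (Y' i)).2) else 0)‖ :=
  sum_le_sum fun Y' _ => by
    rw [norm_keyed_kernel_srcScale_eq ed₁ hcopy ht0 A' A Y' p]
    exact (mul_le_mul_of_nonneg_right (pow_le_one₀ ht0 ht1) (norm_nonneg _)).trans (le_of_eq (one_mul _))

omit [Fintype Γ₁] [DecidableEq Γ₁] [Fintype Γ₂] [DecidableEq Γ₂] in
/-- **READ-BACK of the truncated keyed defect through the rescaling**: on the truncations to source degree `< kk`, the keyed defect of the UNSCALED pair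
is at most `t⁻¹^(kk-1) ×` that of the rescaled pair (`0 < t ≤ 1`; a string with `s < kk` source legs is read back with `t^{-s} ≤ t^{-(kk-1)}`, the others
carry no kernel). [cite: BenfattoGiulianiMastropietro2006, §2.9 (4.6)-(4.8)] -/
theorem sum_filter_norm_keyed_kernel_srcTrunc_le_inv_pow_mul [Fintype Γ₁] [DecidableEq Γ₁] [Fintype Γ₂] [DecidableEq Γ₂] {Bk : Type*} [DecidableEq Bk]
    (ed₁ : (Γ₂ × Fin 2) ≃ Bk × (Γ₁ × Fin 2)) (hcopy : ∀ y : Γ₂ × Fin 2, ((ed₁ y).2).2 = y.2) {t : ℝ} (ht0 : 0 < t) (ht1 : t ≤ 1)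
    (A' : GrassmannAlgebra 𝕜 (Γ₂ × Fin 2)) (A : GrassmannAlgebra 𝕜 (Γ₁ × Fin 2)) (kk k : ℕ) (p : Fin k) (S : Finset (Fin k → Γ₂ × Fin 2)) :
    ∑ Y' ∈ S, ‖kernel 𝕜 (srcTrunc 𝕜 (fun q : Γ₂ × Fin 2 => q.2 = 1) kk A') k Y' -
          (if ∀ i, (ed₁ (Y' i)).1 = (ed₁ (Y' p)).1 then kernel 𝕜 (srcTrunc 𝕜 (fun q : Γ₁ × Fin 2 => q.2 = 1) kk A) k (fun i => (ed₁ (Y' i)).2) else 0)‖ ≤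
      t⁻¹ ^ (kk - 1) * ∑ Y' ∈ S, ‖kernel 𝕜 (srcTrunc 𝕜 (fun q : Γ₂ × Fin 2 => q.2 = 1) kk (srcScale 𝕜 t A')) k Y' -
          (if ∀ i, (ed₁ (Y' i)).1 = (ed₁ (Y' p)).1 then
            kernel 𝕜 (srcTrunc 𝕜 (fun q : Γ₁ × Fin 2 => q.2 = 1) kk (srcScale 𝕜 t A)) k (fun i => (ed₁ (Y' i)).2) else 0)‖ := by
  rw [mul_sum]
  refine sum_le_sum fun Y' _ => ?_
  have hti : 1 ≤ t⁻¹ := one_le_inv_iff₀.2 ⟨ht0, ht1⟩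
  rw [← srcScale_srcTrunc_comm, ← srcScale_srcTrunc_comm, norm_keyed_kernel_srcScale_eq ed₁ hcopy ht0.le, kernel_srcTrunc, kernel_srcTrunc,
    srcCount_residue_eq ed₁ hcopy]
  by_cases hlt : srcCount (fun q : Γ₂ × Fin 2 => q.2 = 1) Y' < kk
  · simp only [hlt, if_true]
    set s := srcCount (fun q : Γ₂ × Fin 2 => q.2 = 1) Y' with hs
    set a := ‖kernel 𝕜 A' k Y' - (if ∀ i, (ed₁ (Y' i)).1 = (ed₁ (Y' p)).1 then kernel 𝕜 A k (fun i => (ed₁ (Y' i)).2) else 0)‖ with ha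
    have ha0 : 0 ≤ a := norm_nonneg _
    have hts : t⁻¹ ^ (kk - 1) * t ^ s = t⁻¹ ^ (kk - 1 - s) := by
      obtain ⟨d, hd⟩ : ∃ d, kk - 1 = s + d := ⟨kk - 1 - s, by omega⟩
      rw [hd, Nat.add_sub_cancel_left, pow_add, mul_comm (t⁻¹ ^ s) (t⁻¹ ^ d), mul_assoc, ← mul_pow, inv_mul_cancel₀ ht0.ne', one_pow, mul_one]
    calc a = 1 * a := (one_mul a).symm
      _ ≤ t⁻¹ ^ (kk - 1 - s) * a := mul_le_mul_of_nonneg_right (one_le_pow₀ hti) ha0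
      _ = t⁻¹ ^ (kk - 1) * (t ^ s * a) := by rw [← mul_assoc, hts]
  · simp only [hlt, if_false, ite_self, sub_zero, norm_zero, mul_zero]
    exact le_rfl

variable {b L Lf M V Ns : ℕ} [NeZero L] [NeZero Lf] [NeZero V]

omit [Fintype Γ₁] [DecidableEq Γ₁] [Fintype Γ₂] [DecidableEq Γ₂] [NeZero L] [NeZero Lf] in
/-- **Even weighted profiles only decrease under the source rescaling**, `0 ≤ t ≤ 1`. [cite: BenfattoGiulianiMastropietro2006, §2.9 (4.6)-(4.8)] -/
theorem WtProfileEven.srcScale {W : GrassmannAlgebra ℂ ((SpaceTimeIdx V M × SectorLeg Ns) × Fin 2)} {Λ : ℝ} {N : ℕ → ℝ}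
    (hW : WtProfileEven W Λ N) {t : ℝ} (ht0 : 0 ≤ t) (ht1 : t ≤ 1) : WtProfileEven (srcScale ℂ t W) Λ N where
  nonneg := hW.nonneg
  le m' j x := by
    refine le_trans (sum_le_sum fun Y _ => ?_) (hW.le m' j x)
    refine mul_le_mul_of_nonneg_right ?_ (add_nonneg zero_le_one (labelDiam_nonneg _ _))
    rw [kernel_srcScale, norm_mul, norm_pow, RCLike.norm_ofReal, abs_of_nonneg ht0]
    exact (mul_le_mul_of_nonneg_right (pow_le_one₀ ht0 ht1) (norm_nonneg _)).trans (le_of_eq (one_mul _))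

omit [Fintype Γ₁] [DecidableEq Γ₁] [Fintype Γ₂] [DecidableEq Γ₂] [NeZero L] [NeZero Lf] in
/-- **Raw weighted profiles only decrease under the source rescaling**, `0 ≤ t ≤ 1`. [cite: BenfattoGiulianiMastropietro2006, §2.9 (4.6)-(4.8)] -/
theorem WtProfileRaw.srcScale {W : GrassmannAlgebra ℂ ((SpaceTimeIdx V M × SectorLeg Ns) × Fin 2)} {Λ : ℝ} {N : ℕ → ℝ}
    (hW : WtProfileRaw W Λ N) {t : ℝ} (ht0 : 0 ≤ t) (ht1 : t ≤ 1) : WtProfileRaw (srcScale ℂ t W) Λ N where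
  nonneg := hW.nonneg
  le k p y := by
    refine le_trans (sum_le_sum fun Y _ => ?_) (hW.le k p y)
    refine mul_le_mul_of_nonneg_right ?_ (add_nonneg zero_le_one (labelDiam_nonneg _ _))
    rw [kernel_srcScale, norm_mul, norm_pow, RCLike.norm_ofReal, abs_of_nonneg ht0]
    exact (mul_le_mul_of_nonneg_right (pow_le_one₀ ht0 ht1) (norm_nonneg _)).trans (le_of_eq (one_mul _))

end Generic

end Summit.HubbardSuperconductivity.HubbardSuperconductivity.Theorems.TwoVolumeDefect

namespace Summit.HubbardSuperconductivity.HubbardSuperconductivity.Theorems.TwoVolumeSource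

set_option linter.dupNamespace false -- summit = problem name (single-conjunct summit), D-0017

open Finset Filter Topology Literature.MathematicalPhysics.QuantumLattice GrassmannAlgebra Literature.Probability.LatticeModels
  Literature.Probability.LatticeModels.BattleFederbush
open Summit.HubbardSuperconductivity.HubbardSuperconductivity.Theorems.TwoPointAssembly
open Summit.HubbardSuperconductivity.HubbardSuperconductivity.Theorems.KLProgrammeLegKernels
open Summit.HubbardSuperconductivity.HubbardSuperconductivity.Theorems.KLRegimeSplit
open Summit.HubbardSuperconductivity.HubbardSuperconductivity.Theorems.EngineV8
open Summit.HubbardSuperconductivity.HubbardSuperconductivity.Theorems.TwoVolumeDefect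

/-! ## §2 The model's rescaled tower: identities, parity, recursion of the truncations, the package at every `t ∈ [0,1]` -/

section Model

variable {V M : ℕ} [NeZero V] [NeZero M]

omit [NeZero M] in
/-- **`klTowerStateS … t j = S_t (klTowerState … j)`**: the rescaled states ARE the rescalings of the states (the step covariances vanish on the sources).
[cite: BenfattoGiulianiMastropietro2006, §2.9 (4.6)-(4.8)] -/
theorem klTowerStateS_eq_srcScale (β U μ : ℝ) (K : TrigPolyC4v) (t : ℝ) (j : ℕ) :
    klTowerStateS V M β U μ K t j = srcScale ℂ t (klTowerState V M β U μ K j) := by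
  cases j with
  | zero => rfl
  | succ k =>
    rw [klTowerStateS_succ, klTowerState_succ, klTowerDS_eq]
    exact effAction_srcScale_comm t (klStepCovD V M β μ K k) (klStepCovD_eq_zero_of_src β μ K k) _

omit [NeZero M] in
/-- **Parity of the rescaled read-outs from the parity of the read-outs.** [folklore] -/
theorem klTowerDS_parity_of_parity (β U μ : ℝ) (K : TrigPolyC4v) (t : ℝ) (j : ℕ)
    (h : klTowerD V M β U μ K j ∈ evenOdd ℂ 0 ∧ constPart ℂ (klTowerD V M β U μ K j) = 0) :
    klTowerDS V M β U μ K t j ∈ evenOdd ℂ 0 ∧ constPart ℂ (klTowerDS V M β U μ K t j) = 0 := by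
  rw [klTowerDS_eq]
  exact ⟨srcScale_mem_evenOdd_zero t h.1, by rw [constPart_srcScale]; exact h.2⟩

omit [NeZero M] in
/-- **Parity of the truncated rescaled read-outs from the parity of the read-outs.** [folklore] -/
theorem srcTrunc_klTowerDS_parity_of_parity (β U μ : ℝ) (K : TrigPolyC4v) (t : ℝ) (j kk : ℕ)
    (h : klTowerD V M β U μ K j ∈ evenOdd ℂ 0 ∧ constPart ℂ (klTowerD V M β U μ K j) = 0) :
    srcTrunc ℂ (fun q : SrcLabel V M j => q.2 = 1) kk (klTowerDS V M β U μ K t j) ∈ evenOdd ℂ 0 ∧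
      constPart ℂ (srcTrunc ℂ (fun q : SrcLabel V M j => q.2 = 1) kk (klTowerDS V M β U μ K t j)) = 0 := by
  obtain ⟨he, h0⟩ := klTowerDS_parity_of_parity β U μ K t j h
  exact ⟨(mem_evenPart_iff).1 (srcTrunc_mem_evenPart ℂ _ kk ((mem_evenPart_iff).2 he)), constPart_srcTrunc_eq_zero ℂ _ kk h0⟩

/-- **Parity of the rescaled read-outs**: `klTowerDS … t j` is even without constant part (given `Z^K_{Λ_{j+1}} ≠ 0`). [folklore] -/
theorem klTowerDS_parity (β U μ : ℝ) (K : TrigPolyC4v) (t : ℝ) (j : ℕ)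
    (hZ : hubbardEffPartitionFnCT V M β U μ 0 K (klScale klE0 (j + 1)) ≠ 0) :
    klTowerDS V M β U μ K t j ∈ evenOdd ℂ 0 ∧ constPart ℂ (klTowerDS V M β U μ K t j) = 0 :=
  klTowerDS_parity_of_parity β U μ K t j (klTowerD_parity β U μ K j hZ)

/-- **Parity of the truncated rescaled read-outs.** [folklore] -/
theorem srcTrunc_klTowerDS_parity (β U μ : ℝ) (K : TrigPolyC4v) (t : ℝ) (j kk : ℕ)
    (hZ : hubbardEffPartitionFnCT V M β U μ 0 K (klScale klE0 (j + 1)) ≠ 0) :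
    srcTrunc ℂ (fun q : SrcLabel V M j => q.2 = 1) kk (klTowerDS V M β U μ K t j) ∈ evenOdd ℂ 0 ∧
      constPart ℂ (srcTrunc ℂ (fun q : SrcLabel V M j => q.2 = 1) kk (klTowerDS V M β U μ K t j)) = 0 := by
  obtain ⟨he, h0⟩ := klTowerDS_parity β U μ K t j hZ
  exact ⟨(mem_evenPart_iff).1 (srcTrunc_mem_evenPart ℂ _ kk ((mem_evenPart_iff).2 he)), constPart_srcTrunc_eq_zero ℂ _ kk h0⟩

omit [NeZero M] in
/-- **Parity of the rescaled states** from the parity of the states. [folklore] -/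
theorem klTowerStateS_parity (β U μ : ℝ) (K : TrigPolyC4v) (t : ℝ) (j : ℕ)
    (h : klTowerState V M β U μ K j ∈ evenOdd ℂ 0 ∧ constPart ℂ (klTowerState V M β U μ K j) = 0) :
    klTowerStateS V M β U μ K t j ∈ evenOdd ℂ 0 ∧ constPart ℂ (klTowerStateS V M β U μ K t j) = 0 := by
  rw [klTowerStateS_eq_srcScale]
  exact ⟨srcScale_mem_evenOdd_zero t h.1, by rw [constPart_srcScale]; exact h.2⟩

/-- **`map T_j (S_t state j) = S_t D_j`**: the transfers are copy-diagonal, so they commute with the rescaling. [cite: BenfattoGiulianiMastropietro2006, §2.7 (2.70)-(2.71), §2.9 (4.6)-(4.8)] -/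
theorem map_klTowerTransfer_klTowerStateS {β : ℝ} (hβ : β ≠ 0) (U μ : ℝ) (K : TrigPolyC4v) (t : ℝ) (j : ℕ)
    (hZ : ∀ k, j = k + 1 → hubbardEffPartitionFnCT V M β U μ 0 K (klScale klE0 (k + 1)) ≠ 0) :
    ExteriorAlgebra.map (Matrix.toLin' (klTowerTransfer V M β μ K j)) (klTowerStateS V M β U μ K t j) = klTowerDS V M β U μ K t j := by
  rw [klTowerStateS_eq_srcScale, map_toLin'_srcScale_comm _ (klTowerTransfer_copyDiagonal β μ K j), map_klTowerTransfer_klTowerState hβ U μ K j hZ,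
    klTowerDS_eq]

/-- **The step shape on the rescaled tower**: `S-state (j+1) = effAction C⁺_j (map T_j (S-state j))`. [folklore] -/
theorem klTowerStateS_succ_eq_effAction_map {β : ℝ} (hβ : β ≠ 0) (U μ : ℝ) (K : TrigPolyC4v) (t : ℝ) (j : ℕ)
    (hZ : ∀ k, j = k + 1 → hubbardEffPartitionFnCT V M β U μ 0 K (klScale klE0 (k + 1)) ≠ 0) :
    klTowerStateS V M β U μ K t (j + 1) =
      effAction ℂ (klStepCovD V M β μ K j) (ExteriorAlgebra.map (Matrix.toLin' (klTowerTransfer V M β μ K j)) (klTowerStateS V M β U μ K t j)) := by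
  rw [map_klTowerTransfer_klTowerStateS hβ U μ K t j hZ]; rfl

/-- **`srcTrunc 3 (klTowerDS … t j) = map T_j (srcTrunc 3 (klTowerStateS … t j))`**: the object of the rescaled profiles IS the re-analysed truncated
rescaled state. [cite: BenfattoGiulianiMastropietro2006, §2.7 (2.70)-(2.71), §2.9 (4.3)-(4.8)] -/
theorem srcTrunc_klTowerDS_eq_map {β : ℝ} (hβ : β ≠ 0) (U μ : ℝ) (K : TrigPolyC4v) (t : ℝ) (j : ℕ) (kk : ℕ)
    (hZ : ∀ k, j = k + 1 → hubbardEffPartitionFnCT V M β U μ 0 K (klScale klE0 (k + 1)) ≠ 0) :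
    srcTrunc ℂ (fun q : SrcLabel V M j => q.2 = 1) kk (klTowerDS V M β U μ K t j) =
      ExteriorAlgebra.map (Matrix.toLin' (klTowerTransfer V M β μ K j))
        (srcTrunc ℂ (fun q : SrcLabel V M (j - 1) => q.2 = 1) kk (klTowerStateS V M β U μ K t j)) := by
  rw [map_toLin'_srcTrunc_comm _ (klTowerTransfer_copyDiagonal β μ K j) kk, map_klTowerTransfer_klTowerStateS hβ U μ K t j hZ]

/-- **The truncated rescaled states obey the tower's recursion**:
`srcTrunc 3 (S-state (j+1)) = srcTrunc 3 (effAction C⁺_j (map T_j (srcTrunc 3 (S-state j))))`. [cite: BenfattoGiulianiMastropietro2006, §2.9 (4.3)-(4.8)] -/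
theorem srcTrunc_klTowerStateS_succ {β : ℝ} (hβ : β ≠ 0) (U μ : ℝ) (K : TrigPolyC4v) (t : ℝ) (j : ℕ) (kk : ℕ)
    (hZ : ∀ k, j = k + 1 → hubbardEffPartitionFnCT V M β U μ 0 K (klScale klE0 (k + 1)) ≠ 0)
    (hZj : hubbardEffPartitionFnCT V M β U μ 0 K (klScale klE0 (j + 1)) ≠ 0) :
    srcTrunc ℂ (fun q : SrcLabel V M j => q.2 = 1) kk (klTowerStateS V M β U μ K t (j + 1)) =
      srcTrunc ℂ (fun q : SrcLabel V M j => q.2 = 1) kk (effAction ℂ (klStepCovD V M β μ K j)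
        (ExteriorAlgebra.map (Matrix.toLin' (klTowerTransfer V M β μ K j))
          (srcTrunc ℂ (fun q : SrcLabel V M (j - 1) => q.2 = 1) kk (klTowerStateS V M β U μ K t j)))) := by
  have h0 : constPart ℂ (klTowerStateS V M β U μ K t j) = 0 := by
    have hD := (klTowerDS_parity β U μ K t j hZj).2
    rw [← map_klTowerTransfer_klTowerStateS hβ U μ K t j hZ, constPart_map] at hD
    exact hD
  rw [klTowerStateS_succ_eq_effAction_map hβ U μ K t j hZ]
  exact (srcTrunc_effAction_map_srcTrunc (klStepCovD V M β μ K j) (klStepCovD_eq_zero_of_src β μ K j) _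
    (klTowerTransfer_copyDiagonal β μ K j) kk h0).symm

end Model

section Package

variable {L b M : ℕ} [NeZero L] [NeZero (b * L)] [NeZero M]

omit [NeZero M] in
/-- **The rescaled truncated keyed defect is at most the truncated keyed defect**, `0 ≤ t ≤ 1`. [cite: BenfattoGiulianiMastropietro2006, §2.9 (4.6)-(4.8)] -/
theorem klKeyedDefectTS_le_klKeyedDefectT (β U μ : ℝ) (Kc Kf : TrigPolyC4v) {t : ℝ} (ht0 : 0 ≤ t) (ht1 : t ≤ 1) (j k : ℕ) (p : Fin k)
    (w : SrcLabel (b * L) M (j - 1)) :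
    klKeyedDefectTS L b M β U μ Kc Kf t j k p w ≤ klKeyedDefectT L b M β U μ Kc Kf j k p w := by
  rw [klKeyedDefectTS_eq, klKeyedDefectT_eq, klTowerStateS_eq_srcScale, klTowerStateS_eq_srcScale, ← srcScale_srcTrunc_comm, ← srcScale_srcTrunc_comm]
  exact sum_filter_norm_keyed_kernel_srcScale_le (klBlockEquivD L b M (j - 1)) (fun y => by obtain ⟨x, s⟩ := y; rw [klBlockEquivD_apply]) ht0 ht1 _ _ k p w

omit [NeZero M] in
/-- **The truncated bundle yields the rescaled truncated bundle at every `t ∈ [0,1]`.** [folklore] -/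
theorem TowerVolumeDataT.scale {V : ℕ} [NeZero V] {β U μ : ℝ} {K : TrigPolyC4v} {J : ℕ} {ε : ℝ} {Λ κ aW sW : ℕ → ℝ} {NV : ℕ → ℕ → ℝ}
    (h : TowerVolumeDataT V M β U μ K J ε Λ κ aW sW NV) {t : ℝ} (ht0 : 0 ≤ t) (ht1 : t ≤ 1) : TowerVolumeDataTS V M β U μ K J ε t Λ κ aW sW NV where
  Z := h.Z
  parity := h.parity
  cov := h.cov
  profile j hj := by
    rw [klTowerDS_eq, ← srcScale_srcTrunc_comm]
    exact (h.profile j hj).srcScale ht0 ht1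

/-- **The truncated package yields the rescaled truncated package at every `t ∈ [0,1]`** (so every discharger of the v10 target discharges the v11 target).
[folklore] -/
def TowerDataT.scale {β U μ : ℝ} (D : TowerDataT β U μ) {t : ℝ} (ht0 : 0 ≤ t) (ht1 : t ≤ 1) : TowerDataTS β U μ t where
  Mth := D.Mth
  r := D.r
  hr := D.hr
  hRd := D.hRd
  Λ := D.Λ
  κ := D.κ
  aW := D.aW
  sW := D.sW
  κ' := D.κ'
  aW' := D.aW'
  sW' := D.sW'
  eW' := D.eW'
  ΛT := D.ΛT
  cW := D.cW
  κf := D.κf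
  cRb := D.cRb
  cCb := D.cCb
  δb := D.δb
  ρ₀ := D.ρ₀
  ρf := D.ρf
  ρ₂ := D.ρ₂
  ρ' := D.ρ'
  ρ₃ := D.ρ₃
  ν₀ := D.ν₀
  ν₁ := D.ν₁
  ν₂ := D.ν₂
  ν₃ := D.ν₃
  ν₄ := D.ν₄
  ν₅ := D.ν₅
  νE := D.νE
  ν₆ := D.ν₆
  ν₇ := D.ν₇
  ν₈ := D.ν₈
  NV := D.NV
  NS := D.NS
  sE := D.sE
  cR := D.cR
  cC := D.cC
  δ := D.δ
  hΛ := D.hΛ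
  hΛmono := D.hΛmono
  hΛT := D.hΛT
  hκ := D.hκ
  haW := D.haW
  hρ := D.hρ
  hNV0 := D.hNV0
  hNSnn := D.hNSnn
  hNS0 := D.hNS0
  hNSsucc := D.hNSsucc
  hsm := D.hsm
  hmis := D.hmis
  hmis0 := D.hmis0
  hdata := by
    filter_upwards [D.hdata] with L hL
    intro b M _ _ _ hM
    obtain ⟨h1, h2, h3⟩ := hL b M hM
    exact ⟨h1.scale ht0 ht1, h2.scale ht0 ht1, h3⟩
  h0 k η hη := by
    filter_upwards [D.h0 k η hη] with L hL
    intro b M _ _ _ hM p w hw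
    exact (klKeyedDefectTS_le_klKeyedDefectT β U μ _ _ ht0 ht1 0 k p w).trans (hL b M hM p w hw)

/-- `Nonempty (TowerDataT β U μ) → ∃ t ∈ (0,1], Nonempty (TowerDataTS β U μ t)` (the v11 target from the v10 target). [folklore] -/
theorem exists_nonempty_towerDataTS_of_towerDataT {β U μ : ℝ} (h : Nonempty (TowerDataT β U μ)) :
    ∃ t : ℝ, 0 < t ∧ t ≤ 1 ∧ Nonempty (TowerDataTS β U μ t) :=
  ⟨1, one_pos, le_rfl, h.map fun D => D.scale zero_le_one le_rfl⟩

end Package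

end Summit.HubbardSuperconductivity.HubbardSuperconductivity.Theorems.TwoVolumeSource

end
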